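import Summits.HodgeConjecture.HodgeConjecture.Theorems.HodgeLocusCensusUnitColumnChain

/-!
# Hodge locus census — the two inequalities of the exact hexagon of the census `p`-complex (PROBE 33)

certified instances and evidence bearing on the general Hodge conjecture; no claim.  Theorem-only helper sheet of the unit-column line over
anchor 351 = PROBE 30 `…UnitColumnChain` (the chain law `chain_law` and the census complex `range_le_ker_of_prime_le` of anchor 229's
multiplicity matrices with free codegrees); nothing here is a statement about Hodge loci.

WHAT.  `K` a field of prime characteristic `p`; `M_c(j → J)` = PROBE 30's multiplicity matrix of `×q^c` on `A = K[x₁,…,x_k]/(xᵢ^{e+2})` between the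
monomials of codegree `j` (rows) and of codegree `J` (columns), acting on row vectors (`Matrix.vecMulLinear`).  Write `p = a + b + c` (three steps,
`a b c : ℕ`, the only hypothesis).  By PROBE 30 (CX-range) `rowspace M_x(· → L) ≤ leftker M_y(L → ·)` whenever `p ≤ x + y`, so the census homology
    `H_(y)(L ← S) := leftker M_y(L → L + y(e+1)) ⧸ rowspace M_{p−y}(S → L)`      (typed `↥ker ⧸ Submodule.comap ker.subtype range`)
is an honest subquotient (the differential arriving at `L` starts at codegree `S`; it is the zero map unless `S + (p−y)(e+1) = L`).  For an
`N`-complex `(C, d)`, `d^N = 0`, and `a + b ≤ N` the sequences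
    `H_(a)(L) →([x] ↦ [x]) H_(a+b)(L) →([x] ↦ [x·d^a]) H_(b)(L + a)`   and   `H_(a+b)(L) →([x] ↦ [x·d^a]) H_(b)(L + a) →([x] ↦ [x]) H_(N−a)(L + a)`
are exact (M. Dubois-Violette, «d^N = 0», K-Theory 14 (1998) 371–404, doi:10.1023/a:1007786403736 = arXiv:q-alg/9710021, LEMMA 1;
M. M. Kapranov, arXiv:q-alg/9611005, Theorem 1.3).  This sheet proves their two dimension shadows for the census `p`-complex `d = ×q`
(`N = p = a + b + c`, codegree steps `e + 1`), at every codegree and with no window hypothesis: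
  §2 (SUB) `finrank_homology_subadditive` — for all `k e a b c j`, at `X = j + b(e+1)`, `J = X + c(e+1)`:
        `dim H_(a+b)(J ← X) ≤ dim H_(a)(J ← j) + dim H_(b)(J + a(e+1) ← X)`;
  §3 (MID) `finrank_homology_le_add` — for all `k e a b c X J` (free codegrees):
        `dim H_(b)(J + a(e+1) ← X) ≤ dim H_(a+b)(J ← X) + dim H_(b+c)(J + a(e+1) ← J)`
     (`H_(b+c) = H_(p−a)`, its arriving differential `M_a` starting at `J`).
Unlike the Boolean inclusion complex of anchors 340/345 (Wilson's identity carries binomial units) the census chain law has coefficient ONE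
(`M_x · M_y = M_{x+y}`, PROBE 30 (CHAIN)), so every inclusion used is an identity of PROBE 30 read at the right codegrees:
  §1 `ker_eq_ker_of_eq` (re-spelling a column codegree: `subst; rfl`), `ker_le_ker` (left kernels grow: `leftker M_a(J → L)
     ≤ leftker M_{a+b}(J → L + b(e+1))`), `range_le_range` (row spaces shrink: `rowspace M_{b+c}(j → X + c(e+1)) ≤ rowspace M_c(X → X + c(e+1))`,
     `X = j + b(e+1)`), `map_range_eq` (`M_a(J → J + a(e+1))` maps `rowspace M_c(X → J)` ONTO `rowspace M_{c+a}(X → J + a(e+1))`),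
     `map_ker_eq_inf` (`M_a` maps `leftker M_{a+b}(J → ·)` ONTO `rowspace M_a(J → J + a(e+1)) ⊓ leftker M_b(J + a(e+1) → ·)`).
  (SUB) = two rank–nullity counts for `x ↦ x · M_a` (on the big kernel: kernel `leftker M_a`, image inside `leftker M_b`; on the big row space:
  image `= rowspace M_{c+a}`, kernel `⊇ rowspace M_{b+c}`); (MID) = the same two counts plus the modular law
  `dim(Z ⊔ B′) + dim(Z ⊓ B′) = dim Z + dim B′` for `Z = leftker M_b`, `B′ = rowspace M_a`, both inside `leftker M_{b+c}` (§1 `ker_le_ker`, (CX-range)).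
RELATION TO THE LINE.  Both laws are stated on anchor 351's matrices verbatim, at every codegree; anchor 349 = PROBE 29's census Betti pattern is the
case `H_(y)(L ← S)` at `(y, L, S) = (c, j + (p−c)(e+1), j)`, whose dimension law needs the window — the hexagon inequalities do not.
NUMERICS FIRST (owner, file-backed under `HOME/pub-hlocus-ivhs-2/gen58/`): `sub33_numerics.py` evaluates both typed inequalities on literal `GF(p)`
census matrices (ranks by Gaussian elimination mod `p`; `dim H = #rows − rank M_y − rank M_{p−y}(S → L)`, valid by (CX-range)) over the whole typed
range (every `a + b + c = p`, including `a = 0 ∨ b = 0 ∨ c = 0`), `p ∈ {2,3,5}`, `k ≤ 5`, `e ≤ 2`: (SUB) all `j` → 3885 instances, 3660 with equality,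
225 strict, 0 violations; (MID) all `X, J ≤ k(e+1)` → 35 705 instances (14 668 with left side `> 0`), 18 610 strict, 0 violations; ONE kit job
(`kit33.py`, p ∈ {2,3,5,7}; k ≤ 7 ∧ e ≤ 2, k ≤ 6 ∧ e ≤ 3, k ≤ 9 ∧ e ≤ 1): (SUB) 42 048 instances, (MID) 525 892 instances, 0 violations.  Job id and
file hashes are in the READY line.
LITERATURE (context only; nothing imported or minted): as displayed.  No literature fact is used as a hypothesis.
EVIDENCE CLASS: kernel theorems about the census matrices; no census number changes; nothing here asserts anything about the Hodge conjecture.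

Import: anchor 351 = PROBE 30 `…Theorems.HodgeLocusCensusUnitColumnChain` BY NAME (hence anchor 229 and gen 31's `colR`); theorem-only,
definition-free; Mathlib by name: `Submodule.finrank_quotient_add_finrank`, `Submodule.comapSubtypeEquivOfLe`, `Submodule.finrank_mono`,
`Submodule.comap_mono`, `Submodule.map_comap_le`, `Submodule.finrank_map_subtype_eq`, `Submodule.finrank_sup_add_finrank_inf_eq`, `Submodule.range_subtype`,
`LinearMap.finrank_range_add_finrank_ker`, `LinearMap.ker_comp`, `LinearMap.range_comp`, `LinearEquiv.finrank_eq`, `Matrix.vecMul_vecMul`, `Matrix.zero_vecMul`.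
-/

set_option linter.dupNamespace false
set_option autoImplicit false

namespace Summit.HodgeConjecture.HodgeConjecture.HodgeLocus.Census.UnitColumnHexagon

open Summit.HodgeConjecture.HodgeConjecture.HodgeLocus.Census.ModelNonJumpC1All (colR)
open Summit.HodgeConjecture.HodgeConjecture.HodgeLocus.Census.UnitColumnChain (chain_law range_le_ker_of_prime_le)

/-! ## §1 tools: codegree transport; kernels grow, row spaces shrink and move along the ladder (chain law, any field) -/

/-- column-codegree transport for left kernels (`subst; rfl`). -/
theorem ker_eq_ker_of_eq (K : Type*) [Field K] (k e c J : ℕ) {L₁ L₂ : ℕ} (h : L₁ = L₂) :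
    LinearMap.ker (Matrix.vecMulLinear
      (Matrix.of fun (v : {v : Fin k → Fin (e + 2) // (∑ i, (v i : ℕ)) + J = k * (e + 1)})
          (m : {m : Fin k → Fin (e + 2) // (∑ i, (m i : ℕ)) + (L₁) = k * (e + 1)}) =>
        ((((List.flatMap (colR (e + 3)))^[c] [List.ofFn (fun i => (m.1 i : ℕ))]).count (List.ofFn (fun i => (v.1 i : ℕ))) : ℕ) : K))) =
    LinearMap.ker (Matrix.vecMulLinear
      (Matrix.of fun (v : {v : Fin k → Fin (e + 2) // (∑ i, (v i : ℕ)) + J = k * (e + 1)})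
          (m : {m : Fin k → Fin (e + 2) // (∑ i, (m i : ℕ)) + (L₂) = k * (e + 1)}) =>
        ((((List.flatMap (colR (e + 3)))^[c] [List.ofFn (fun i => (m.1 i : ℕ))]).count (List.ofFn (fun i => (v.1 i : ℕ))) : ℕ) : K))) := by
  subst h; rfl

/-- left kernels grow along the ladder: `leftker M_a(J → L) ≤ leftker M_{a+b}(J → L + b(e+1))`. -/
theorem ker_le_ker (K : Type*) [Field K] (k e a b J L : ℕ) :
    LinearMap.ker (Matrix.vecMulLinear
      (Matrix.of fun (v : {v : Fin k → Fin (e + 2) // (∑ i, (v i : ℕ)) + J = k * (e + 1)})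
          (m : {m : Fin k → Fin (e + 2) // (∑ i, (m i : ℕ)) + L = k * (e + 1)}) =>
        ((((List.flatMap (colR (e + 3)))^[a] [List.ofFn (fun i => (m.1 i : ℕ))]).count (List.ofFn (fun i => (v.1 i : ℕ))) : ℕ) : K))) ≤
    LinearMap.ker (Matrix.vecMulLinear
      (Matrix.of fun (v : {v : Fin k → Fin (e + 2) // (∑ i, (v i : ℕ)) + J = k * (e + 1)})
          (m : {m : Fin k → Fin (e + 2) // (∑ i, (m i : ℕ)) + (L + b * (e + 1)) = k * (e + 1)}) =>
        ((((List.flatMap (colR (e + 3)))^[a + b] [List.ofFn (fun i => (m.1 i : ℕ))]).count (List.ofFn (fun i => (v.1 i : ℕ))) : ℕ) : K))) := by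
  intro x hx
  rw [LinearMap.mem_ker, Matrix.vecMulLinear_apply] at hx ⊢
  rw [← chain_law K k e a b J L, ← Matrix.vecMul_vecMul, hx, Matrix.zero_vecMul]

/-- row spaces shrink along the ladder: `rowspace M_{b+c}(j → X + c(e+1)) ≤ rowspace M_c(X → X + c(e+1))` for `X = j + b(e+1)`. -/
theorem range_le_range (K : Type*) [Field K] (k e b c j : ℕ) :
    LinearMap.range (Matrix.vecMulLinear
      (Matrix.of fun (v : {v : Fin k → Fin (e + 2) // (∑ i, (v i : ℕ)) + j = k * (e + 1)})
          (m : {m : Fin k → Fin (e + 2) // (∑ i, (m i : ℕ)) + (j + b * (e + 1) + c * (e + 1)) = k * (e + 1)}) =>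
        ((((List.flatMap (colR (e + 3)))^[b + c] [List.ofFn (fun i => (m.1 i : ℕ))]).count (List.ofFn (fun i => (v.1 i : ℕ))) : ℕ) : K))) ≤
    LinearMap.range (Matrix.vecMulLinear
      (Matrix.of fun (v : {v : Fin k → Fin (e + 2) // (∑ i, (v i : ℕ)) + (j + b * (e + 1)) = k * (e + 1)})
          (m : {m : Fin k → Fin (e + 2) // (∑ i, (m i : ℕ)) + (j + b * (e + 1) + c * (e + 1)) = k * (e + 1)}) =>
        ((((List.flatMap (colR (e + 3)))^[c] [List.ofFn (fun i => (m.1 i : ℕ))]).count (List.ofFn (fun i => (v.1 i : ℕ))) : ℕ) : K))) := by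
  rintro _ ⟨y, rfl⟩
  refine ⟨Matrix.vecMul y
    (Matrix.of fun (v : {v : Fin k → Fin (e + 2) // (∑ i, (v i : ℕ)) + j = k * (e + 1)})
        (m : {m : Fin k → Fin (e + 2) // (∑ i, (m i : ℕ)) + (j + b * (e + 1)) = k * (e + 1)}) =>
      ((((List.flatMap (colR (e + 3)))^[b] [List.ofFn (fun i => (m.1 i : ℕ))]).count (List.ofFn (fun i => (v.1 i : ℕ))) : ℕ) : K)), ?_⟩
  rw [Matrix.vecMulLinear_apply, Matrix.vecMulLinear_apply, Matrix.vecMul_vecMul, chain_law K k e b c j (j + b * (e + 1))]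

/-- row spaces move along the ladder: `M_a(J → J + a(e+1))` maps `rowspace M_c(X → J)` ONTO `rowspace M_{c+a}(X → J + a(e+1))`. -/
theorem map_range_eq (K : Type*) [Field K] (k e c a X J : ℕ) :
    Submodule.map (Matrix.vecMulLinear
      (Matrix.of fun (v : {v : Fin k → Fin (e + 2) // (∑ i, (v i : ℕ)) + J = k * (e + 1)})
          (m : {m : Fin k → Fin (e + 2) // (∑ i, (m i : ℕ)) + (J + a * (e + 1)) = k * (e + 1)}) =>
        ((((List.flatMap (colR (e + 3)))^[a] [List.ofFn (fun i => (m.1 i : ℕ))]).count (List.ofFn (fun i => (v.1 i : ℕ))) : ℕ) : K)))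
      (LinearMap.range (Matrix.vecMulLinear
      (Matrix.of fun (v : {v : Fin k → Fin (e + 2) // (∑ i, (v i : ℕ)) + X = k * (e + 1)})
          (m : {m : Fin k → Fin (e + 2) // (∑ i, (m i : ℕ)) + J = k * (e + 1)}) =>
        ((((List.flatMap (colR (e + 3)))^[c] [List.ofFn (fun i => (m.1 i : ℕ))]).count (List.ofFn (fun i => (v.1 i : ℕ))) : ℕ) : K)))) =
    LinearMap.range (Matrix.vecMulLinear
      (Matrix.of fun (v : {v : Fin k → Fin (e + 2) // (∑ i, (v i : ℕ)) + X = k * (e + 1)})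
          (m : {m : Fin k → Fin (e + 2) // (∑ i, (m i : ℕ)) + (J + a * (e + 1)) = k * (e + 1)}) =>
        ((((List.flatMap (colR (e + 3)))^[c + a] [List.ofFn (fun i => (m.1 i : ℕ))]).count (List.ofFn (fun i => (v.1 i : ℕ))) : ℕ) : K))) := by
  apply le_antisymm
  · rintro _ ⟨_, ⟨y, rfl⟩, rfl⟩
    exact ⟨y, by rw [Matrix.vecMulLinear_apply, Matrix.vecMulLinear_apply, Matrix.vecMulLinear_apply, Matrix.vecMul_vecMul, chain_law K k e c a X J]⟩
  · rintro _ ⟨y, rfl⟩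
    exact ⟨Matrix.vecMul y
      (Matrix.of fun (v : {v : Fin k → Fin (e + 2) // (∑ i, (v i : ℕ)) + X = k * (e + 1)})
          (m : {m : Fin k → Fin (e + 2) // (∑ i, (m i : ℕ)) + J = k * (e + 1)}) =>
        ((((List.flatMap (colR (e + 3)))^[c] [List.ofFn (fun i => (m.1 i : ℕ))]).count (List.ofFn (fun i => (v.1 i : ℕ))) : ℕ) : K)), ⟨y, rfl⟩, by
      rw [Matrix.vecMulLinear_apply, Matrix.vecMulLinear_apply, Matrix.vecMul_vecMul, chain_law K k e c a X J]⟩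

/-- big kernels move along the ladder: `M_a(J → J + a(e+1))` maps `leftker M_{a+b}(J → J + (a+b)(e+1))` ONTO
`rowspace M_a(J → J + a(e+1)) ⊓ leftker M_b(J + a(e+1) → J + a(e+1) + b(e+1))`. -/
theorem map_ker_eq_inf (K : Type*) [Field K] (k e a b J : ℕ) :
    Submodule.map (Matrix.vecMulLinear
      (Matrix.of fun (v : {v : Fin k → Fin (e + 2) // (∑ i, (v i : ℕ)) + J = k * (e + 1)})
          (m : {m : Fin k → Fin (e + 2) // (∑ i, (m i : ℕ)) + (J + a * (e + 1)) = k * (e + 1)}) =>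
        ((((List.flatMap (colR (e + 3)))^[a] [List.ofFn (fun i => (m.1 i : ℕ))]).count (List.ofFn (fun i => (v.1 i : ℕ))) : ℕ) : K)))
      (LinearMap.ker (Matrix.vecMulLinear
      (Matrix.of fun (v : {v : Fin k → Fin (e + 2) // (∑ i, (v i : ℕ)) + J = k * (e + 1)})
          (m : {m : Fin k → Fin (e + 2) // (∑ i, (m i : ℕ)) + (J + (a + b) * (e + 1)) = k * (e + 1)}) =>
        ((((List.flatMap (colR (e + 3)))^[a + b] [List.ofFn (fun i => (m.1 i : ℕ))]).count (List.ofFn (fun i => (v.1 i : ℕ))) : ℕ) : K)))) =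
    LinearMap.range (Matrix.vecMulLinear
      (Matrix.of fun (v : {v : Fin k → Fin (e + 2) // (∑ i, (v i : ℕ)) + J = k * (e + 1)})
          (m : {m : Fin k → Fin (e + 2) // (∑ i, (m i : ℕ)) + (J + a * (e + 1)) = k * (e + 1)}) =>
        ((((List.flatMap (colR (e + 3)))^[a] [List.ofFn (fun i => (m.1 i : ℕ))]).count (List.ofFn (fun i => (v.1 i : ℕ))) : ℕ) : K))) ⊓
    LinearMap.ker (Matrix.vecMulLinear
      (Matrix.of fun (v : {v : Fin k → Fin (e + 2) // (∑ i, (v i : ℕ)) + (J + a * (e + 1)) = k * (e + 1)})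
          (m : {m : Fin k → Fin (e + 2) // (∑ i, (m i : ℕ)) + (J + a * (e + 1) + b * (e + 1)) = k * (e + 1)}) =>
        ((((List.flatMap (colR (e + 3)))^[b] [List.ofFn (fun i => (m.1 i : ℕ))]).count (List.ofFn (fun i => (v.1 i : ℕ))) : ℕ) : K))) := by
  have hk := ker_eq_ker_of_eq K k e (a + b) J (show J + a * (e + 1) + b * (e + 1) = J + (a + b) * (e + 1) by ring)
  apply le_antisymm
  · rintro _ ⟨x, hx, rfl⟩
    rw [SetLike.mem_coe, ← hk, LinearMap.mem_ker, Matrix.vecMulLinear_apply] at hx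
    refine ⟨⟨x, rfl⟩, ?_⟩
    rw [SetLike.mem_coe, LinearMap.mem_ker, Matrix.vecMulLinear_apply, Matrix.vecMulLinear_apply, Matrix.vecMul_vecMul,
      chain_law K k e a b J (J + a * (e + 1)), hx]
  · rintro _ ⟨⟨x, rfl⟩, hy⟩
    rw [SetLike.mem_coe, LinearMap.mem_ker, Matrix.vecMulLinear_apply, Matrix.vecMulLinear_apply, Matrix.vecMul_vecMul,
      chain_law K k e a b J (J + a * (e + 1))] at hy
    refine ⟨x, ?_, rfl⟩
    rw [SetLike.mem_coe, ← hk, LinearMap.mem_ker, Matrix.vecMulLinear_apply, hy]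

/-! ## §2 (SUB) THE FIRST INEQUALITY OF THE HEXAGON: SUBADDITIVITY -/

/-- **(SUB) SUBADDITIVITY of the census homology.**  For `a + b + c = p` and every `k e j`, at `X = j + b(e+1)`, `J = X + c(e+1)`:
`dim H_(a+b)(J ← X) ≤ dim H_(a)(J ← j) + dim H_(b)(J + a(e+1) ← X)`, the three census homologies typed as honest subquotients of PROBE 30's
matrices (left kernel of `M_y` at the column step `y(e+1)`, modulo the row space of `M_{p−y}` arriving from below). -/
theorem finrank_homology_subadditive (K : Type*) [Field K] (p : ℕ) [CharP K p] (hp : p.Prime) (k e a b c j : ℕ) (habc : a + b + c = p) :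
    Module.finrank K (↥(LinearMap.ker (Matrix.vecMulLinear
      (Matrix.of fun (v : {v : Fin k → Fin (e + 2) // (∑ i, (v i : ℕ)) + (j + b * (e + 1) + c * (e + 1)) = k * (e + 1)})
          (m : {m : Fin k → Fin (e + 2) // (∑ i, (m i : ℕ)) + (j + b * (e + 1) + c * (e + 1) + (a + b) * (e + 1)) = k * (e + 1)}) =>
        ((((List.flatMap (colR (e + 3)))^[a + b] [List.ofFn (fun i => (m.1 i : ℕ))]).count (List.ofFn (fun i => (v.1 i : ℕ))) : ℕ) : K)))) ⧸
      Submodule.comap (LinearMap.ker (Matrix.vecMulLinear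
      (Matrix.of fun (v : {v : Fin k → Fin (e + 2) // (∑ i, (v i : ℕ)) + (j + b * (e + 1) + c * (e + 1)) = k * (e + 1)})
          (m : {m : Fin k → Fin (e + 2) // (∑ i, (m i : ℕ)) + (j + b * (e + 1) + c * (e + 1) + (a + b) * (e + 1)) = k * (e + 1)}) =>
        ((((List.flatMap (colR (e + 3)))^[a + b] [List.ofFn (fun i => (m.1 i : ℕ))]).count (List.ofFn (fun i => (v.1 i : ℕ))) : ℕ) : K)))).subtype
        (LinearMap.range (Matrix.vecMulLinear
      (Matrix.of fun (v : {v : Fin k → Fin (e + 2) // (∑ i, (v i : ℕ)) + (j + b * (e + 1)) = k * (e + 1)})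
          (m : {m : Fin k → Fin (e + 2) // (∑ i, (m i : ℕ)) + (j + b * (e + 1) + c * (e + 1)) = k * (e + 1)}) =>
        ((((List.flatMap (colR (e + 3)))^[c] [List.ofFn (fun i => (m.1 i : ℕ))]).count (List.ofFn (fun i => (v.1 i : ℕ))) : ℕ) : K))))) ≤
    Module.finrank K (↥(LinearMap.ker (Matrix.vecMulLinear
      (Matrix.of fun (v : {v : Fin k → Fin (e + 2) // (∑ i, (v i : ℕ)) + (j + b * (e + 1) + c * (e + 1)) = k * (e + 1)})
          (m : {m : Fin k → Fin (e + 2) // (∑ i, (m i : ℕ)) + (j + b * (e + 1) + c * (e + 1) + a * (e + 1)) = k * (e + 1)}) =>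
        ((((List.flatMap (colR (e + 3)))^[a] [List.ofFn (fun i => (m.1 i : ℕ))]).count (List.ofFn (fun i => (v.1 i : ℕ))) : ℕ) : K)))) ⧸
      Submodule.comap (LinearMap.ker (Matrix.vecMulLinear
      (Matrix.of fun (v : {v : Fin k → Fin (e + 2) // (∑ i, (v i : ℕ)) + (j + b * (e + 1) + c * (e + 1)) = k * (e + 1)})
          (m : {m : Fin k → Fin (e + 2) // (∑ i, (m i : ℕ)) + (j + b * (e + 1) + c * (e + 1) + a * (e + 1)) = k * (e + 1)}) =>
        ((((List.flatMap (colR (e + 3)))^[a] [List.ofFn (fun i => (m.1 i : ℕ))]).count (List.ofFn (fun i => (v.1 i : ℕ))) : ℕ) : K)))).subtype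
        (LinearMap.range (Matrix.vecMulLinear
      (Matrix.of fun (v : {v : Fin k → Fin (e + 2) // (∑ i, (v i : ℕ)) + j = k * (e + 1)})
          (m : {m : Fin k → Fin (e + 2) // (∑ i, (m i : ℕ)) + (j + b * (e + 1) + c * (e + 1)) = k * (e + 1)}) =>
        ((((List.flatMap (colR (e + 3)))^[b + c] [List.ofFn (fun i => (m.1 i : ℕ))]).count (List.ofFn (fun i => (v.1 i : ℕ))) : ℕ) : K))))) +
    Module.finrank K (↥(LinearMap.ker (Matrix.vecMulLinear
      (Matrix.of fun (v : {v : Fin k → Fin (e + 2) // (∑ i, (v i : ℕ)) + (j + b * (e + 1) + c * (e + 1) + a * (e + 1)) = k * (e + 1)})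
          (m : {m : Fin k → Fin (e + 2) // (∑ i, (m i : ℕ)) + (j + b * (e + 1) + c * (e + 1) + a * (e + 1) + b * (e + 1)) = k * (e + 1)}) =>
        ((((List.flatMap (colR (e + 3)))^[b] [List.ofFn (fun i => (m.1 i : ℕ))]).count (List.ofFn (fun i => (v.1 i : ℕ))) : ℕ) : K)))) ⧸
      Submodule.comap (LinearMap.ker (Matrix.vecMulLinear
      (Matrix.of fun (v : {v : Fin k → Fin (e + 2) // (∑ i, (v i : ℕ)) + (j + b * (e + 1) + c * (e + 1) + a * (e + 1)) = k * (e + 1)})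
          (m : {m : Fin k → Fin (e + 2) // (∑ i, (m i : ℕ)) + (j + b * (e + 1) + c * (e + 1) + a * (e + 1) + b * (e + 1)) = k * (e + 1)}) =>
        ((((List.flatMap (colR (e + 3)))^[b] [List.ofFn (fun i => (m.1 i : ℕ))]).count (List.ofFn (fun i => (v.1 i : ℕ))) : ℕ) : K)))).subtype
        (LinearMap.range (Matrix.vecMulLinear
      (Matrix.of fun (v : {v : Fin k → Fin (e + 2) // (∑ i, (v i : ℕ)) + (j + b * (e + 1)) = k * (e + 1)})
          (m : {m : Fin k → Fin (e + 2) // (∑ i, (m i : ℕ)) + (j + b * (e + 1) + c * (e + 1) + a * (e + 1)) = k * (e + 1)}) =>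
        ((((List.flatMap (colR (e + 3)))^[c + a] [List.ofFn (fun i => (m.1 i : ℕ))]).count (List.ofFn (fun i => (v.1 i : ℕ))) : ℕ) : K))))) := by
  -- the five inclusions (PROBE 30: chain law and census complex)
  have f1 := ker_le_ker K k e a b (j + b * (e + 1) + c * (e + 1)) (j + b * (e + 1) + c * (e + 1) + a * (e + 1))
  rw [ker_eq_ker_of_eq K k e (a + b) (j + b * (e + 1) + c * (e + 1))
    (show j + b * (e + 1) + c * (e + 1) + a * (e + 1) + b * (e + 1) = j + b * (e + 1) + c * (e + 1) + (a + b) * (e + 1) by ring)] at f1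
  have f2 := range_le_ker_of_prime_le K p hp k e c (a + b) (j + b * (e + 1)) (j + b * (e + 1) + c * (e + 1)) (by omega)
  have f3 := range_le_ker_of_prime_le K p hp k e (b + c) a j (j + b * (e + 1) + c * (e + 1)) (by omega)
  have f4 := range_le_ker_of_prime_le K p hp k e (c + a) b (j + b * (e + 1)) (j + b * (e + 1) + c * (e + 1) + a * (e + 1)) (by omega)
  have f5 := range_le_range K k e b c j
  -- the three quotient dimensions
  have hq1 := Submodule.finrank_quotient_add_finrank (Submodule.comap (LinearMap.ker (Matrix.vecMulLinear
      (Matrix.of fun (v : {v : Fin k → Fin (e + 2) // (∑ i, (v i : ℕ)) + (j + b * (e + 1) + c * (e + 1)) = k * (e + 1)})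
          (m : {m : Fin k → Fin (e + 2) // (∑ i, (m i : ℕ)) + (j + b * (e + 1) + c * (e + 1) + (a + b) * (e + 1)) = k * (e + 1)}) =>
        ((((List.flatMap (colR (e + 3)))^[a + b] [List.ofFn (fun i => (m.1 i : ℕ))]).count (List.ofFn (fun i => (v.1 i : ℕ))) : ℕ) : K)))).subtype
        (LinearMap.range (Matrix.vecMulLinear
      (Matrix.of fun (v : {v : Fin k → Fin (e + 2) // (∑ i, (v i : ℕ)) + (j + b * (e + 1)) = k * (e + 1)})
          (m : {m : Fin k → Fin (e + 2) // (∑ i, (m i : ℕ)) + (j + b * (e + 1) + c * (e + 1)) = k * (e + 1)}) =>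
        ((((List.flatMap (colR (e + 3)))^[c] [List.ofFn (fun i => (m.1 i : ℕ))]).count (List.ofFn (fun i => (v.1 i : ℕ))) : ℕ) : K)))))
  rw [LinearEquiv.finrank_eq (Submodule.comapSubtypeEquivOfLe f2)] at hq1
  have hq2 := Submodule.finrank_quotient_add_finrank (Submodule.comap (LinearMap.ker (Matrix.vecMulLinear
      (Matrix.of fun (v : {v : Fin k → Fin (e + 2) // (∑ i, (v i : ℕ)) + (j + b * (e + 1) + c * (e + 1)) = k * (e + 1)})
          (m : {m : Fin k → Fin (e + 2) // (∑ i, (m i : ℕ)) + (j + b * (e + 1) + c * (e + 1) + a * (e + 1)) = k * (e + 1)}) =>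
        ((((List.flatMap (colR (e + 3)))^[a] [List.ofFn (fun i => (m.1 i : ℕ))]).count (List.ofFn (fun i => (v.1 i : ℕ))) : ℕ) : K)))).subtype
        (LinearMap.range (Matrix.vecMulLinear
      (Matrix.of fun (v : {v : Fin k → Fin (e + 2) // (∑ i, (v i : ℕ)) + j = k * (e + 1)})
          (m : {m : Fin k → Fin (e + 2) // (∑ i, (m i : ℕ)) + (j + b * (e + 1) + c * (e + 1)) = k * (e + 1)}) =>
        ((((List.flatMap (colR (e + 3)))^[b + c] [List.ofFn (fun i => (m.1 i : ℕ))]).count (List.ofFn (fun i => (v.1 i : ℕ))) : ℕ) : K)))))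
  rw [LinearEquiv.finrank_eq (Submodule.comapSubtypeEquivOfLe f3)] at hq2
  have hq3 := Submodule.finrank_quotient_add_finrank (Submodule.comap (LinearMap.ker (Matrix.vecMulLinear
      (Matrix.of fun (v : {v : Fin k → Fin (e + 2) // (∑ i, (v i : ℕ)) + (j + b * (e + 1) + c * (e + 1) + a * (e + 1)) = k * (e + 1)})
          (m : {m : Fin k → Fin (e + 2) // (∑ i, (m i : ℕ)) + (j + b * (e + 1) + c * (e + 1) + a * (e + 1) + b * (e + 1)) = k * (e + 1)}) =>
        ((((List.flatMap (colR (e + 3)))^[b] [List.ofFn (fun i => (m.1 i : ℕ))]).count (List.ofFn (fun i => (v.1 i : ℕ))) : ℕ) : K)))).subtype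
        (LinearMap.range (Matrix.vecMulLinear
      (Matrix.of fun (v : {v : Fin k → Fin (e + 2) // (∑ i, (v i : ℕ)) + (j + b * (e + 1)) = k * (e + 1)})
          (m : {m : Fin k → Fin (e + 2) // (∑ i, (m i : ℕ)) + (j + b * (e + 1) + c * (e + 1) + a * (e + 1)) = k * (e + 1)}) =>
        ((((List.flatMap (colR (e + 3)))^[c + a] [List.ofFn (fun i => (m.1 i : ℕ))]).count (List.ofFn (fun i => (v.1 i : ℕ))) : ℕ) : K)))))
  rw [LinearEquiv.finrank_eq (Submodule.comapSubtypeEquivOfLe f4)] at hq3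
  -- `x ↦ x · M_a` on the big kernel: rank–nullity, kernel, image
  have e2 := LinearMap.finrank_range_add_finrank_ker ((Matrix.vecMulLinear
      (Matrix.of fun (v : {v : Fin k → Fin (e + 2) // (∑ i, (v i : ℕ)) + (j + b * (e + 1) + c * (e + 1)) = k * (e + 1)})
          (m : {m : Fin k → Fin (e + 2) // (∑ i, (m i : ℕ)) + (j + b * (e + 1) + c * (e + 1) + a * (e + 1)) = k * (e + 1)}) =>
        ((((List.flatMap (colR (e + 3)))^[a] [List.ofFn (fun i => (m.1 i : ℕ))]).count (List.ofFn (fun i => (v.1 i : ℕ))) : ℕ) : K))).comp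
      (LinearMap.ker (Matrix.vecMulLinear
      (Matrix.of fun (v : {v : Fin k → Fin (e + 2) // (∑ i, (v i : ℕ)) + (j + b * (e + 1) + c * (e + 1)) = k * (e + 1)})
          (m : {m : Fin k → Fin (e + 2) // (∑ i, (m i : ℕ)) + (j + b * (e + 1) + c * (e + 1) + (a + b) * (e + 1)) = k * (e + 1)}) =>
        ((((List.flatMap (colR (e + 3)))^[a + b] [List.ofFn (fun i => (m.1 i : ℕ))]).count (List.ofFn (fun i => (v.1 i : ℕ))) : ℕ) : K)))).subtype)
  rw [LinearMap.ker_comp, LinearEquiv.finrank_eq (Submodule.comapSubtypeEquivOfLe f1), LinearMap.range_comp, Submodule.range_subtype] at e2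
  have m1 := Submodule.finrank_mono ((map_ker_eq_inf K k e a b (j + b * (e + 1) + c * (e + 1))).le.trans inf_le_right)
  -- `x ↦ x · M_a` on the big row space: rank–nullity, image, kernel
  have e1 := LinearMap.finrank_range_add_finrank_ker ((Matrix.vecMulLinear
      (Matrix.of fun (v : {v : Fin k → Fin (e + 2) // (∑ i, (v i : ℕ)) + (j + b * (e + 1) + c * (e + 1)) = k * (e + 1)})
          (m : {m : Fin k → Fin (e + 2) // (∑ i, (m i : ℕ)) + (j + b * (e + 1) + c * (e + 1) + a * (e + 1)) = k * (e + 1)}) =>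
        ((((List.flatMap (colR (e + 3)))^[a] [List.ofFn (fun i => (m.1 i : ℕ))]).count (List.ofFn (fun i => (v.1 i : ℕ))) : ℕ) : K))).comp
      (LinearMap.range (Matrix.vecMulLinear
      (Matrix.of fun (v : {v : Fin k → Fin (e + 2) // (∑ i, (v i : ℕ)) + (j + b * (e + 1)) = k * (e + 1)})
          (m : {m : Fin k → Fin (e + 2) // (∑ i, (m i : ℕ)) + (j + b * (e + 1) + c * (e + 1)) = k * (e + 1)}) =>
        ((((List.flatMap (colR (e + 3)))^[c] [List.ofFn (fun i => (m.1 i : ℕ))]).count (List.ofFn (fun i => (v.1 i : ℕ))) : ℕ) : K)))).subtype)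
  rw [LinearMap.ker_comp, LinearMap.range_comp, Submodule.range_subtype, map_range_eq K k e c a (j + b * (e + 1)) (j + b * (e + 1) + c * (e + 1))] at e1
  have m2 := Submodule.finrank_mono (Submodule.comap_mono (f := (LinearMap.range (Matrix.vecMulLinear
      (Matrix.of fun (v : {v : Fin k → Fin (e + 2) // (∑ i, (v i : ℕ)) + (j + b * (e + 1)) = k * (e + 1)})
          (m : {m : Fin k → Fin (e + 2) // (∑ i, (m i : ℕ)) + (j + b * (e + 1) + c * (e + 1)) = k * (e + 1)}) =>
        ((((List.flatMap (colR (e + 3)))^[c] [List.ofFn (fun i => (m.1 i : ℕ))]).count (List.ofFn (fun i => (v.1 i : ℕ))) : ℕ) : K)))).subtype) f3)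
  rw [LinearEquiv.finrank_eq (Submodule.comapSubtypeEquivOfLe f5)] at m2
  omega

/-! ## §3 (MID) THE SECOND INEQUALITY OF THE HEXAGON -/

/-- **(MID) the second inequality of the hexagon.**  For `a + b + c = p` and all `k e X J` (free codegrees):
`dim H_(b)(J + a(e+1) ← X) ≤ dim H_(a+b)(J ← X) + dim H_(b+c)(J + a(e+1) ← J)`. -/
theorem finrank_homology_le_add (K : Type*) [Field K] (p : ℕ) [CharP K p] (hp : p.Prime) (k e a b c X J : ℕ) (habc : a + b + c = p) :
    Module.finrank K (↥(LinearMap.ker (Matrix.vecMulLinear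
      (Matrix.of fun (v : {v : Fin k → Fin (e + 2) // (∑ i, (v i : ℕ)) + (J + a * (e + 1)) = k * (e + 1)})
          (m : {m : Fin k → Fin (e + 2) // (∑ i, (m i : ℕ)) + (J + a * (e + 1) + b * (e + 1)) = k * (e + 1)}) =>
        ((((List.flatMap (colR (e + 3)))^[b] [List.ofFn (fun i => (m.1 i : ℕ))]).count (List.ofFn (fun i => (v.1 i : ℕ))) : ℕ) : K)))) ⧸
      Submodule.comap (LinearMap.ker (Matrix.vecMulLinear
      (Matrix.of fun (v : {v : Fin k → Fin (e + 2) // (∑ i, (v i : ℕ)) + (J + a * (e + 1)) = k * (e + 1)})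
          (m : {m : Fin k → Fin (e + 2) // (∑ i, (m i : ℕ)) + (J + a * (e + 1) + b * (e + 1)) = k * (e + 1)}) =>
        ((((List.flatMap (colR (e + 3)))^[b] [List.ofFn (fun i => (m.1 i : ℕ))]).count (List.ofFn (fun i => (v.1 i : ℕ))) : ℕ) : K)))).subtype
        (LinearMap.range (Matrix.vecMulLinear
      (Matrix.of fun (v : {v : Fin k → Fin (e + 2) // (∑ i, (v i : ℕ)) + X = k * (e + 1)})
          (m : {m : Fin k → Fin (e + 2) // (∑ i, (m i : ℕ)) + (J + a * (e + 1)) = k * (e + 1)}) =>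
        ((((List.flatMap (colR (e + 3)))^[c + a] [List.ofFn (fun i => (m.1 i : ℕ))]).count (List.ofFn (fun i => (v.1 i : ℕ))) : ℕ) : K))))) ≤
    Module.finrank K (↥(LinearMap.ker (Matrix.vecMulLinear
      (Matrix.of fun (v : {v : Fin k → Fin (e + 2) // (∑ i, (v i : ℕ)) + J = k * (e + 1)})
          (m : {m : Fin k → Fin (e + 2) // (∑ i, (m i : ℕ)) + (J + (a + b) * (e + 1)) = k * (e + 1)}) =>
        ((((List.flatMap (colR (e + 3)))^[a + b] [List.ofFn (fun i => (m.1 i : ℕ))]).count (List.ofFn (fun i => (v.1 i : ℕ))) : ℕ) : K)))) ⧸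
      Submodule.comap (LinearMap.ker (Matrix.vecMulLinear
      (Matrix.of fun (v : {v : Fin k → Fin (e + 2) // (∑ i, (v i : ℕ)) + J = k * (e + 1)})
          (m : {m : Fin k → Fin (e + 2) // (∑ i, (m i : ℕ)) + (J + (a + b) * (e + 1)) = k * (e + 1)}) =>
        ((((List.flatMap (colR (e + 3)))^[a + b] [List.ofFn (fun i => (m.1 i : ℕ))]).count (List.ofFn (fun i => (v.1 i : ℕ))) : ℕ) : K)))).subtype
        (LinearMap.range (Matrix.vecMulLinear
      (Matrix.of fun (v : {v : Fin k → Fin (e + 2) // (∑ i, (v i : ℕ)) + X = k * (e + 1)})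
          (m : {m : Fin k → Fin (e + 2) // (∑ i, (m i : ℕ)) + J = k * (e + 1)}) =>
        ((((List.flatMap (colR (e + 3)))^[c] [List.ofFn (fun i => (m.1 i : ℕ))]).count (List.ofFn (fun i => (v.1 i : ℕ))) : ℕ) : K))))) +
    Module.finrank K (↥(LinearMap.ker (Matrix.vecMulLinear
      (Matrix.of fun (v : {v : Fin k → Fin (e + 2) // (∑ i, (v i : ℕ)) + (J + a * (e + 1)) = k * (e + 1)})
          (m : {m : Fin k → Fin (e + 2) // (∑ i, (m i : ℕ)) + (J + a * (e + 1) + (b + c) * (e + 1)) = k * (e + 1)}) =>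
        ((((List.flatMap (colR (e + 3)))^[b + c] [List.ofFn (fun i => (m.1 i : ℕ))]).count (List.ofFn (fun i => (v.1 i : ℕ))) : ℕ) : K)))) ⧸
      Submodule.comap (LinearMap.ker (Matrix.vecMulLinear
      (Matrix.of fun (v : {v : Fin k → Fin (e + 2) // (∑ i, (v i : ℕ)) + (J + a * (e + 1)) = k * (e + 1)})
          (m : {m : Fin k → Fin (e + 2) // (∑ i, (m i : ℕ)) + (J + a * (e + 1) + (b + c) * (e + 1)) = k * (e + 1)}) =>
        ((((List.flatMap (colR (e + 3)))^[b + c] [List.ofFn (fun i => (m.1 i : ℕ))]).count (List.ofFn (fun i => (v.1 i : ℕ))) : ℕ) : K)))).subtype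
        (LinearMap.range (Matrix.vecMulLinear
      (Matrix.of fun (v : {v : Fin k → Fin (e + 2) // (∑ i, (v i : ℕ)) + J = k * (e + 1)})
          (m : {m : Fin k → Fin (e + 2) // (∑ i, (m i : ℕ)) + (J + a * (e + 1)) = k * (e + 1)}) =>
        ((((List.flatMap (colR (e + 3)))^[a] [List.ofFn (fun i => (m.1 i : ℕ))]).count (List.ofFn (fun i => (v.1 i : ℕ))) : ℕ) : K))))) := by
  -- inclusions (PROBE 30: chain law and census complex)
  have f1 := ker_le_ker K k e a b J (J + a * (e + 1))
  rw [ker_eq_ker_of_eq K k e (a + b) J (show J + a * (e + 1) + b * (e + 1) = J + (a + b) * (e + 1) by ring)] at f1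
  have f2 := range_le_ker_of_prime_le K p hp k e c (a + b) X J (by omega)
  have f4 := range_le_ker_of_prime_le K p hp k e (c + a) b X (J + a * (e + 1)) (by omega)
  have f6 := range_le_ker_of_prime_le K p hp k e a (b + c) J (J + a * (e + 1)) (by omega)
  have f7 := ker_le_ker K k e b c (J + a * (e + 1)) (J + a * (e + 1) + b * (e + 1))
  rw [ker_eq_ker_of_eq K k e (b + c) (J + a * (e + 1))
    (show J + a * (e + 1) + b * (e + 1) + c * (e + 1) = J + a * (e + 1) + (b + c) * (e + 1) by ring)] at f7
  -- the three quotient dimensions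
  have hq1 := Submodule.finrank_quotient_add_finrank (Submodule.comap (LinearMap.ker (Matrix.vecMulLinear
      (Matrix.of fun (v : {v : Fin k → Fin (e + 2) // (∑ i, (v i : ℕ)) + (J + a * (e + 1)) = k * (e + 1)})
          (m : {m : Fin k → Fin (e + 2) // (∑ i, (m i : ℕ)) + (J + a * (e + 1) + b * (e + 1)) = k * (e + 1)}) =>
        ((((List.flatMap (colR (e + 3)))^[b] [List.ofFn (fun i => (m.1 i : ℕ))]).count (List.ofFn (fun i => (v.1 i : ℕ))) : ℕ) : K)))).subtype
        (LinearMap.range (Matrix.vecMulLinear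
      (Matrix.of fun (v : {v : Fin k → Fin (e + 2) // (∑ i, (v i : ℕ)) + X = k * (e + 1)})
          (m : {m : Fin k → Fin (e + 2) // (∑ i, (m i : ℕ)) + (J + a * (e + 1)) = k * (e + 1)}) =>
        ((((List.flatMap (colR (e + 3)))^[c + a] [List.ofFn (fun i => (m.1 i : ℕ))]).count (List.ofFn (fun i => (v.1 i : ℕ))) : ℕ) : K)))))
  rw [LinearEquiv.finrank_eq (Submodule.comapSubtypeEquivOfLe f4)] at hq1
  have hq2 := Submodule.finrank_quotient_add_finrank (Submodule.comap (LinearMap.ker (Matrix.vecMulLinear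
      (Matrix.of fun (v : {v : Fin k → Fin (e + 2) // (∑ i, (v i : ℕ)) + J = k * (e + 1)})
          (m : {m : Fin k → Fin (e + 2) // (∑ i, (m i : ℕ)) + (J + (a + b) * (e + 1)) = k * (e + 1)}) =>
        ((((List.flatMap (colR (e + 3)))^[a + b] [List.ofFn (fun i => (m.1 i : ℕ))]).count (List.ofFn (fun i => (v.1 i : ℕ))) : ℕ) : K)))).subtype
        (LinearMap.range (Matrix.vecMulLinear
      (Matrix.of fun (v : {v : Fin k → Fin (e + 2) // (∑ i, (v i : ℕ)) + X = k * (e + 1)})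
          (m : {m : Fin k → Fin (e + 2) // (∑ i, (m i : ℕ)) + J = k * (e + 1)}) =>
        ((((List.flatMap (colR (e + 3)))^[c] [List.ofFn (fun i => (m.1 i : ℕ))]).count (List.ofFn (fun i => (v.1 i : ℕ))) : ℕ) : K)))))
  rw [LinearEquiv.finrank_eq (Submodule.comapSubtypeEquivOfLe f2)] at hq2
  have hq3 := Submodule.finrank_quotient_add_finrank (Submodule.comap (LinearMap.ker (Matrix.vecMulLinear
      (Matrix.of fun (v : {v : Fin k → Fin (e + 2) // (∑ i, (v i : ℕ)) + (J + a * (e + 1)) = k * (e + 1)})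
          (m : {m : Fin k → Fin (e + 2) // (∑ i, (m i : ℕ)) + (J + a * (e + 1) + (b + c) * (e + 1)) = k * (e + 1)}) =>
        ((((List.flatMap (colR (e + 3)))^[b + c] [List.ofFn (fun i => (m.1 i : ℕ))]).count (List.ofFn (fun i => (v.1 i : ℕ))) : ℕ) : K)))).subtype
        (LinearMap.range (Matrix.vecMulLinear
      (Matrix.of fun (v : {v : Fin k → Fin (e + 2) // (∑ i, (v i : ℕ)) + J = k * (e + 1)})
          (m : {m : Fin k → Fin (e + 2) // (∑ i, (m i : ℕ)) + (J + a * (e + 1)) = k * (e + 1)}) =>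
        ((((List.flatMap (colR (e + 3)))^[a] [List.ofFn (fun i => (m.1 i : ℕ))]).count (List.ofFn (fun i => (v.1 i : ℕ))) : ℕ) : K)))))
  rw [LinearEquiv.finrank_eq (Submodule.comapSubtypeEquivOfLe f6)] at hq3
  -- the modular law inside the biggest kernel
  have s1 := Submodule.finrank_sup_add_finrank_inf_eq (LinearMap.ker (Matrix.vecMulLinear
      (Matrix.of fun (v : {v : Fin k → Fin (e + 2) // (∑ i, (v i : ℕ)) + (J + a * (e + 1)) = k * (e + 1)})
          (m : {m : Fin k → Fin (e + 2) // (∑ i, (m i : ℕ)) + (J + a * (e + 1) + b * (e + 1)) = k * (e + 1)}) =>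
        ((((List.flatMap (colR (e + 3)))^[b] [List.ofFn (fun i => (m.1 i : ℕ))]).count (List.ofFn (fun i => (v.1 i : ℕ))) : ℕ) : K))))
      (LinearMap.range (Matrix.vecMulLinear
      (Matrix.of fun (v : {v : Fin k → Fin (e + 2) // (∑ i, (v i : ℕ)) + J = k * (e + 1)})
          (m : {m : Fin k → Fin (e + 2) // (∑ i, (m i : ℕ)) + (J + a * (e + 1)) = k * (e + 1)}) =>
        ((((List.flatMap (colR (e + 3)))^[a] [List.ofFn (fun i => (m.1 i : ℕ))]).count (List.ofFn (fun i => (v.1 i : ℕ))) : ℕ) : K))))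
  have s2 := Submodule.finrank_mono (sup_le f7 f6)
  -- `x ↦ x · M_a` on the big kernel and on the big row space
  have e2 := LinearMap.finrank_range_add_finrank_ker ((Matrix.vecMulLinear
      (Matrix.of fun (v : {v : Fin k → Fin (e + 2) // (∑ i, (v i : ℕ)) + J = k * (e + 1)})
          (m : {m : Fin k → Fin (e + 2) // (∑ i, (m i : ℕ)) + (J + a * (e + 1)) = k * (e + 1)}) =>
        ((((List.flatMap (colR (e + 3)))^[a] [List.ofFn (fun i => (m.1 i : ℕ))]).count (List.ofFn (fun i => (v.1 i : ℕ))) : ℕ) : K))).comp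
      (LinearMap.ker (Matrix.vecMulLinear
      (Matrix.of fun (v : {v : Fin k → Fin (e + 2) // (∑ i, (v i : ℕ)) + J = k * (e + 1)})
          (m : {m : Fin k → Fin (e + 2) // (∑ i, (m i : ℕ)) + (J + (a + b) * (e + 1)) = k * (e + 1)}) =>
        ((((List.flatMap (colR (e + 3)))^[a + b] [List.ofFn (fun i => (m.1 i : ℕ))]).count (List.ofFn (fun i => (v.1 i : ℕ))) : ℕ) : K)))).subtype)
  rw [LinearMap.ker_comp, LinearEquiv.finrank_eq (Submodule.comapSubtypeEquivOfLe f1), LinearMap.range_comp, Submodule.range_subtype,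
    map_ker_eq_inf K k e a b J, inf_comm] at e2
  have e1 := LinearMap.finrank_range_add_finrank_ker ((Matrix.vecMulLinear
      (Matrix.of fun (v : {v : Fin k → Fin (e + 2) // (∑ i, (v i : ℕ)) + J = k * (e + 1)})
          (m : {m : Fin k → Fin (e + 2) // (∑ i, (m i : ℕ)) + (J + a * (e + 1)) = k * (e + 1)}) =>
        ((((List.flatMap (colR (e + 3)))^[a] [List.ofFn (fun i => (m.1 i : ℕ))]).count (List.ofFn (fun i => (v.1 i : ℕ))) : ℕ) : K))).comp
      (LinearMap.range (Matrix.vecMulLinear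
      (Matrix.of fun (v : {v : Fin k → Fin (e + 2) // (∑ i, (v i : ℕ)) + X = k * (e + 1)})
          (m : {m : Fin k → Fin (e + 2) // (∑ i, (m i : ℕ)) + J = k * (e + 1)}) =>
        ((((List.flatMap (colR (e + 3)))^[c] [List.ofFn (fun i => (m.1 i : ℕ))]).count (List.ofFn (fun i => (v.1 i : ℕ))) : ℕ) : K)))).subtype)
  rw [LinearMap.ker_comp, LinearMap.range_comp, Submodule.range_subtype, map_range_eq K k e c a X J] at e1
  have e3 := Submodule.finrank_mono (Submodule.map_comap_le (LinearMap.range (Matrix.vecMulLinear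
      (Matrix.of fun (v : {v : Fin k → Fin (e + 2) // (∑ i, (v i : ℕ)) + X = k * (e + 1)})
          (m : {m : Fin k → Fin (e + 2) // (∑ i, (m i : ℕ)) + J = k * (e + 1)}) =>
        ((((List.flatMap (colR (e + 3)))^[c] [List.ofFn (fun i => (m.1 i : ℕ))]).count (List.ofFn (fun i => (v.1 i : ℕ))) : ℕ) : K)))).subtype
      (LinearMap.ker (Matrix.vecMulLinear
      (Matrix.of fun (v : {v : Fin k → Fin (e + 2) // (∑ i, (v i : ℕ)) + J = k * (e + 1)})
          (m : {m : Fin k → Fin (e + 2) // (∑ i, (m i : ℕ)) + (J + a * (e + 1)) = k * (e + 1)}) =>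
        ((((List.flatMap (colR (e + 3)))^[a] [List.ofFn (fun i => (m.1 i : ℕ))]).count (List.ofFn (fun i => (v.1 i : ℕ))) : ℕ) : K)))))
  rw [Submodule.finrank_map_subtype_eq] at e3
  omega

end Summit.HodgeConjecture.HodgeConjecture.HodgeLocus.Census.UnitColumnHexagon
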